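import Literature.AnabelianGeometry.EtaleTheta.Discharge.Sec1TranslatesNonTorsion
import Literature.AnabelianGeometry.EtaleTheta.Discharge.Sec1LogUddNotKummer
import HarnessLib

/-!
# [EtTh] §1: the `Z`-translates of a theta class are pairwise non-torsion — binder `hL` DISCHARGED

Mochizuki, *The étale theta function …*, Publ. RIMS **45** (2009) [EtTh], Prop. 1.5 (ii)–(iii), PRIMS PDF p. 23
[cite: MochizukiEtTh2009, Prop 1.5 (iii) p.23]. Layer L2 of the abc-iut cell, seat abc-iut-L2-t1 (root owner; lineage
file `Sec1TranslatesNonTorsion`, gen 3). That file proved the non-torsion of `σ · x · x⁻¹` (`x` a theta class,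
`σ ↦ a ≠ 0` in `Z`) CONDITIONALLY on the binder
`hL : ∀ n : ℤ, log(Ü)ⁿ ∈ F̈² → n = 0` (GAP row G-L2t1-1). abc-iut-L2-t7's `Sec1LogUddNotKummer`
(`EtaleThetaData.logUdd_zpow_mem_Fdd2_imp`) DERIVED `hL` from `Compat`, the vacuity guard `IsEtThOrigin`,
`Prop15iii` and `Prop15ii`. This proof-only junction file substitutes the derivation: the four non-torsion
statements and the `H'`-restricted variant's reduction now take `hO : D.IsEtThOrigin` in place of `hL`
(every other hypothesis unchanged). Nothing new is asserted about [EtTh]; typed ≠ proved; no side taken on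
[IUTchIII] Cor. 3.12.
-/

noncomputable section

namespace Literature.AnabelianGeometry.EtaleTheta

open Literature.AnabelianGeometry.SemiGraphs
open scoped IsMulCommutative

namespace ThetaSetting

variable {p : ℕ} [Fact p.Prime] {D : ThetaSetting p}

namespace EtaleThetaData

variable (E : D.EtaleThetaData)

/-- **`σ · x − x` is not a torsion class for `σ ↦ a ≠ 0`** (`x ∈ O^×_K̈ · η̈^Θ`), under `Compat`, `IsEtThOrigin`,
`Prop15iii`, `Prop15ii` — the binder `hL` of `not_isOfFinOrder_conj_div` discharged by
`logUdd_zpow_mem_Fdd2_imp`. [cite: MochizukiEtTh2009, Prop 1.5 (iii) p.23] -/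
theorem not_isOfFinOrder_conj_div_of_origin (hC : D.Compat) (hO : D.IsEtThOrigin) (h15 : Prop15iii E hC)
    (h15ii : Prop15ii E.toKummerData hC) {σ : D.PiTemp} (hσ : D.toZ σ ≠ 1) {x : D.H1 D.GtpYdd}
    (hx : x ∈ E.thetaClasses) :
    haveI := hC.GtpYdd_normal
    ¬ IsOfFinOrder (ContH1.conj D.toTheta D.DeltaTheta σ x * x⁻¹) :=
  E.not_isOfFinOrder_conj_div hC h15 h15ii (E.logUdd_zpow_mem_Fdd2_imp hC hO h15 h15ii) hσ hx

/-- **`(P14iii-cl)` unconditionally in `hL`**: for `γ ↦ a ≠ 0` and `k ≠ 0`, `γᵏ · x · x⁻¹` is not torsion.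
[cite: MochizukiEtTh2009, Prop 1.5 (iii) p.23] -/
theorem not_isOfFinOrder_conj_zpow_div_of_origin (hC : D.Compat) (hO : D.IsEtThOrigin) (h15 : Prop15iii E hC)
    (h15ii : Prop15ii E.toKummerData hC) {γ : D.PiTemp} (hγ : D.toZ γ ≠ 1) {k : ℤ} (hk : k ≠ 0)
    {x : D.H1 D.GtpYdd} (hx : x ∈ E.thetaClasses) :
    haveI := hC.GtpYdd_normal
    ¬ IsOfFinOrder (ContH1.conj D.toTheta D.DeltaTheta (γ ^ k) x * x⁻¹) :=
  E.not_isOfFinOrder_conj_zpow_div hC h15 h15ii (E.logUdd_zpow_mem_Fdd2_imp hC hO h15 h15ii) hγ hk hx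

/-- The same with a natural-number exponent `k ≠ 0`. [cite: MochizukiEtTh2009, Prop 1.5 (iii) p.23] -/
theorem not_isOfFinOrder_conj_pow_div_of_origin (hC : D.Compat) (hO : D.IsEtThOrigin) (h15 : Prop15iii E hC)
    (h15ii : Prop15ii E.toKummerData hC) {γ : D.PiTemp} (hγ : D.toZ γ ≠ 1) {k : ℕ} (hk : k ≠ 0)
    {x : D.H1 D.GtpYdd} (hx : x ∈ E.thetaClasses) :
    haveI := hC.GtpYdd_normal
    ¬ IsOfFinOrder (ContH1.conj D.toTheta D.DeltaTheta (γ ^ k) x * x⁻¹) :=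
  E.not_isOfFinOrder_conj_pow_div hC h15 h15ii (E.logUdd_zpow_mem_Fdd2_imp hC hO h15 h15ii) hγ hk hx

/-- **Distinct translates**: for `m ≠ n`, `γᵐ · x · (γⁿ · x)⁻¹` is not torsion, unconditionally in `hL`.
[cite: MochizukiEtTh2009, Prop 1.5 (iii) p.23] -/
theorem not_isOfFinOrder_conj_zpow_div_conj_zpow_of_origin (hC : D.Compat) (hO : D.IsEtThOrigin)
    (h15 : Prop15iii E hC) (h15ii : Prop15ii E.toKummerData hC) {γ : D.PiTemp} (hγ : D.toZ γ ≠ 1) {m n : ℤ}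
    (hmn : m ≠ n) {x : D.H1 D.GtpYdd} (hx : x ∈ E.thetaClasses) :
    haveI := hC.GtpYdd_normal
    ¬ IsOfFinOrder (ContH1.conj D.toTheta D.DeltaTheta (γ ^ m) x *
      (ContH1.conj D.toTheta D.DeltaTheta (γ ^ n) x)⁻¹) :=
  E.not_isOfFinOrder_conj_zpow_div_conj_zpow hC h15 h15ii (E.logUdd_zpow_mem_Fdd2_imp hC hO h15 h15ii) hγ hmn hx

/-- **`log(Ü)` has infinite order on `(H' ∩ Δ^tp_X)^Θ`** when every `m`-th power of `(Δ^tp_Ÿ)^Θ` lies there (`m ≠ 0`) —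
the reduction `logUdd_infiniteOrderOn_of_pow_mem` with its binder `hL` discharged. [cite: MochizukiEtTh2009, Prop 1.5 (ii) p.23] -/
theorem logUdd_infiniteOrderOn_of_pow_mem_of_origin (hC : D.Compat) (hO : D.IsEtThOrigin) (h15 : Prop15iii E hC)
    (h15ii : Prop15ii E.toKummerData hC) {H' : Subgroup D.PiTemp} (hH' : H' ≤ D.GtpYdd) {m : ℕ} (hm : m ≠ 0)
    (hpow : ∀ g ∈ (D.DtpYddN 1).map D.toTheta, g ^ m ∈ (H' ⊓ D.DeltaTemp).map D.toTheta) (n : ℤ)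
    (hn : ContH1.res (MonoidHom.id D.GtpTheta) D.DeltaTheta
        ((map_inf_deltaTemp_le_DtpYddTheta hH').trans
          (Subgroup.map_mono inf_le_left : (D.DtpYddN 1).map D.toTheta ≤ D.GtpYdd.map D.toTheta))
        (E.toKummerData.logUdd ^ n) = 1) : n = 0 :=
  E.toKummerData.logUdd_infiniteOrderOn_of_pow_mem (E.logUdd_zpow_mem_Fdd2_imp hC hO h15 h15ii) hH' hm hpow n hn

/-- **Restricted form, binder `hL` discharged**: for `H' ≤ Π^tp_Ÿ` with the power condition `hpow` (`m ≠ 0`), `γ ↦ a ≠ 0`,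
`k ≠ 0` and a theta class `x`, the restriction to `H'` of `γᵏ · x · x⁻¹` is not torsion.
[cite: MochizukiEtTh2009, Prop 1.5 (iii) p.23] -/
theorem not_isOfFinOrder_res_conj_zpow_div_of_origin (hC : D.Compat) (hO : D.IsEtThOrigin) (h15 : Prop15iii E hC)
    (h15ii : Prop15ii E.toKummerData hC) {H' : Subgroup D.PiTemp} (hH' : H' ≤ D.GtpYdd) {m : ℕ} (hm : m ≠ 0)
    (hpow : ∀ g ∈ (D.DtpYddN 1).map D.toTheta, g ^ m ∈ (H' ⊓ D.DeltaTemp).map D.toTheta)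
    {γ : D.PiTemp} (hγ : D.toZ γ ≠ 1) {k : ℤ} (hk : k ≠ 0) {x : D.H1 D.GtpYdd} (hx : x ∈ E.thetaClasses) :
    haveI := hC.GtpYdd_normal
    ¬ IsOfFinOrder (ContH1.res D.toTheta D.DeltaTheta hH' (ContH1.conj D.toTheta D.DeltaTheta (γ ^ k) x * x⁻¹)) :=
  E.not_isOfFinOrder_res_conj_zpow_div hC h15 h15ii (E.logUdd_zpow_mem_Fdd2_imp hC hO h15 h15ii) hH' hm hpow hγ hk hx

/-- **Pulled-back form, binder `hL` discharged** (the shape consumed in §2 / [IUTchII]).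
[cite: MochizukiEtTh2009, Prop 1.5 (iii) p.23] -/
theorem not_isOfFinOrder_comap_conj_zpow_div_of_origin (hC : D.Compat) (hO : D.IsEtThOrigin) (h15 : Prop15iii E hC)
    (h15ii : Prop15ii E.toKummerData hC) {G₀ : Type*} [Group G₀] [TopologicalSpace G₀] {ι : G₀ →* D.PiTemp}
    (hι : Continuous ι) {H₀ : Subgroup G₀} (hH₀ : H₀.map ι ≤ D.GtpYdd) {m : ℕ} (hm : m ≠ 0)
    (hpow : ∀ g ∈ (D.DtpYddN 1).map D.toTheta, g ^ m ∈ (H₀.map ι ⊓ D.DeltaTemp).map D.toTheta)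
    {γ : D.PiTemp} (hγ : D.toZ γ ≠ 1) {k : ℤ} (hk : k ≠ 0) {x : D.H1 D.GtpYdd} (hx : x ∈ E.thetaClasses) :
    haveI := hC.GtpYdd_normal
    ¬ IsOfFinOrder (ContH1.comap D.toTheta D.DeltaTheta ι hι hH₀ (ContH1.conj D.toTheta D.DeltaTheta (γ ^ k) x * x⁻¹)) :=
  E.not_isOfFinOrder_comap_conj_zpow_div hC h15 h15ii (E.logUdd_zpow_mem_Fdd2_imp hC hO h15 h15ii) hι hH₀ hm hpow
    hγ hk hx

/-- The same for a single `σ ↦ a ≠ 0` (no power condition on `σ`), binder `hL` discharged.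
[cite: MochizukiEtTh2009, Prop 1.5 (iii) p.23] -/
theorem not_isOfFinOrder_comap_conj_div_of_origin (hC : D.Compat) (hO : D.IsEtThOrigin) (h15 : Prop15iii E hC)
    (h15ii : Prop15ii E.toKummerData hC) {G₀ : Type*} [Group G₀] [TopologicalSpace G₀] {ι : G₀ →* D.PiTemp}
    (hι : Continuous ι) {H₀ : Subgroup G₀} (hH₀ : H₀.map ι ≤ D.GtpYdd) {m : ℕ} (hm : m ≠ 0)
    (hpow : ∀ g ∈ (D.DtpYddN 1).map D.toTheta, g ^ m ∈ (H₀.map ι ⊓ D.DeltaTemp).map D.toTheta)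
    {σ : D.PiTemp} (hσ : D.toZ σ ≠ 1) {x : D.H1 D.GtpYdd} (hx : x ∈ E.thetaClasses) :
    haveI := hC.GtpYdd_normal
    ¬ IsOfFinOrder (ContH1.comap D.toTheta D.DeltaTheta ι hι hH₀ (ContH1.conj D.toTheta D.DeltaTheta σ x * x⁻¹)) :=
  E.not_isOfFinOrder_comap_conj_div hC h15 h15ii (E.logUdd_zpow_mem_Fdd2_imp hC hO h15 h15ii) hι hH₀ hm hpow hσ hx

end EtaleThetaData

end ThetaSetting

end Literature.AnabelianGeometry.EtaleTheta

end
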